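import Mathlib.Analysis.InnerProductSpace.l2Space
import Mathlib.Analysis.InnerProductSpace.Adjoint
import Mathlib.Analysis.Normed.Operator.Compact.Basic
import HarnessLib

/-!
# ENGINE-KL layer (K5, transport) for `SqueezedSkewness.TorusKL` (stmt-QuantumFields-23204, stub `stub_torusMixtureData`):
# TRANSPORT OF HILBERT-SPACE DATA TO `ℓ²(ℕ, ℂ)` AND TO AN `ℕ`-INDEX

Pure Hilbert-space plumbing (Mathlib only):
* §1 an orthonormal family in a separable inner-product space is countable; a separable Hilbert space embeds ISOMETRICALLY into
  `ℓ²(ℕ, ℂ)` (`nonempty_linearIsometry_l2`);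
* §2 ★ `transport` — along an isometry `J : H → E` a compact self-adjoint positive `P` and a norm-preserving representation `U`
  commuting with `P` become `P' = J P J†`, `U' = J U J† + (1 − J J†)` on `E` with the SAME properties and
  `P'^n (U'_x (J ψ)) = J (P^n (U_x ψ))`;
* §3 `exists_nat_reindex` — a countable family of data with non-negative weights is re-indexed by `ℕ` (padding with weight `0` and a
  default datum) without changing any weighted `HasSum`.
Seat `ym-line-fcl-p3` g16; theorems only; nothing about a summit, NT or the mass gap.  [folklore]
References: M. Reed, B. Simon, *Methods of Modern Mathematical Physics I* (1980), §II.3 (separable Hilbert spaces ≅ ℓ²), §VI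
[cite: ReedSimonI1980, Thm II.7].
-/

set_option autoImplicit false

noncomputable section

open scoped InnerProductSpace ComplexConjugate
open Function

namespace Summit.QuantumFields.YangMills.Theorems.TorusKL.Transport

variable {H : Type*} [NormedAddCommGroup H] [InnerProductSpace ℂ H]

/-! ## §1 Separable Hilbert spaces embed into `ℓ²(ℕ, ℂ)` -/

/-- In a separable inner-product space every orthonormal family is countable (the balls of radius `√2/2` about its members are
disjoint). [folklore] -/
theorem countable_of_orthonormal [TopologicalSpace.SeparableSpace H] {ι : Type*} {v : ι → H} (hv : Orthonormal ℂ v) :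
    Countable ι := by
  refine Pairwise.countable_of_isOpen_disjoint (s := fun i => Metric.ball (v i) (Real.sqrt 2 / 2)) (fun i j hij => ?_)
    (fun i => Metric.isOpen_ball) (fun i => ⟨v i, Metric.mem_ball_self (by positivity)⟩)
  refine Set.disjoint_left.2 fun z hzi hzj => ?_
  rw [Metric.mem_ball, dist_eq_norm] at hzi hzj
  have h2 : ‖v i - v j‖ ^ 2 = 2 := by
    rw [norm_sub_sq (𝕜 := ℂ), hv.1 i, hv.1 j, hv.2 hij, map_zero]; norm_num
  have hlt : ‖v i - v j‖ < Real.sqrt 2 := by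
    calc ‖v i - v j‖ = ‖(v i - z) + (z - v j)‖ := by rw [sub_add_sub_cancel]
      _ ≤ ‖v i - z‖ + ‖z - v j‖ := norm_add_le _ _
      _ < Real.sqrt 2 / 2 + Real.sqrt 2 / 2 := by rw [norm_sub_rev (v i) z]; exact add_lt_add hzi hzj
      _ = Real.sqrt 2 := by ring
  nlinarith [norm_nonneg (v i - v j), Real.sqrt_nonneg 2, Real.sq_sqrt (show (0 : ℝ) ≤ 2 by norm_num)]

/-- A separable Hilbert space embeds ISOMETRICALLY into `ℓ²(ℕ, ℂ)` (coordinates in a countable Hilbert basis, re-indexed along an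
injection into `ℕ`). [cite: ReedSimonI1980, Thm II.7] -/
theorem nonempty_linearIsometry_l2 [CompleteSpace H] [TopologicalSpace.SeparableSpace H] :
    Nonempty (H →ₗᵢ[ℂ] lp (fun _ : ℕ => ℂ) 2) := by
  classical
  obtain ⟨w, b, hb⟩ := exists_hilbertBasis ℂ H
  haveI : Countable w := countable_of_orthonormal b.orthonormal
  obtain ⟨f, hf⟩ := Countable.exists_injective_nat w
  have hon : Orthonormal ℂ (fun i : w => (lp.single 2 (f i) (1 : ℂ) : lp (fun _ : ℕ => ℂ) 2)) := by
    rw [orthonormal_iff_ite]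
    intro i j
    rw [lp.inner_single_left, lp.single_apply]
    by_cases h : i = j
    · subst h; simp
    · rw [Pi.single_eq_of_ne (hf.ne h), inner_zero_right, if_neg h]
  exact ⟨hon.orthogonalFamily.linearIsometry.comp b.repr.toLinearIsometry⟩

/-! ## §2 Transport of operators along an isometry -/

section Transport

variable {E : Type*} [NormedAddCommGroup E] [InnerProductSpace ℂ E] [CompleteSpace E] [CompleteSpace H]

/-- For an isometry `J`, `J† J = 1`. [folklore] -/
theorem adjoint_comp_self_of_isometry (J : H →ₗᵢ[ℂ] E) :
    (J.toContinuousLinearMap).adjoint ∘L J.toContinuousLinearMap = 1 := by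
  ext v
  refine ext_inner_right ℂ fun w => ?_
  rw [ContinuousLinearMap.comp_apply, ContinuousLinearMap.adjoint_inner_left, one_apply_eq_self]
  exact J.inner_map_map v w

/-- ★ **Transport along an isometry.**  A compact self-adjoint positive `P` and a norm-preserving representation `U` of an additive
monoid commuting with `P` on `H` are carried by an isometry `J : H → E` to `P' = J P J†`, `U'_x = J U_x J† + (1 − J J†)` on `E`
with the same properties, and `P'^n (U'_x (J ψ)) = J (P^n (U_x ψ))`. [folklore] -/
theorem transport (J : H →ₗᵢ[ℂ] E) {X : Type*} [AddMonoid X] (P : H →L[ℂ] H) (U : X → H →L[ℂ] H)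
    (hPsa : IsSelfAdjoint P) (hPc : IsCompactOperator P) (hPpos : ∀ v, 0 ≤ RCLike.re ⟪P v, v⟫_ℂ) (hU0 : U 0 = 1)
    (hUadd : ∀ x y, U (x + y) = U x * U y) (hUnorm : ∀ x v, ‖U x v‖ = ‖v‖) (hPU : ∀ x, P * U x = U x * P) :
    ∃ (P' : E →L[ℂ] E) (U' : X → E →L[ℂ] E), IsSelfAdjoint P' ∧ IsCompactOperator P' ∧ (∀ v, 0 ≤ RCLike.re ⟪P' v, v⟫_ℂ) ∧
      U' 0 = 1 ∧ (∀ x y, U' (x + y) = U' x * U' y) ∧ (∀ x v, ‖U' x v‖ = ‖v‖) ∧ (∀ x, P' * U' x = U' x * P') ∧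
      ∀ (n : ℕ) (x : X) (ψ : H), (P' ^ n) (U' x (J ψ)) = J ((P ^ n) (U x ψ)) := by
  obtain ⟨Jc, hJc⟩ : ∃ Jc : H →L[ℂ] E, Jc = J.toContinuousLinearMap := ⟨_, rfl⟩
  have hJ : ∀ v, Jc v = J v := fun v => by rw [hJc]; rfl
  have hAJ : Jc.adjoint ∘L Jc = 1 := by rw [hJc]; exact adjoint_comp_self_of_isometry J
  have hAJv : ∀ v, Jc.adjoint (Jc v) = v := fun v => by
    have h := congrArg (fun T : H →L[ℂ] H => T v) hAJ
    simpa only [ContinuousLinearMap.comp_apply, one_apply_eq_self] using h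
  have hAQ : ∀ v, Jc.adjoint ((1 - Jc ∘L Jc.adjoint) v) = 0 := fun v => by
    simp only [sub_apply, one_apply_eq_self, ContinuousLinearMap.comp_apply, map_sub, hAJv,
      sub_self]
  have hPUv : ∀ x w, P (U x w) = U x (P w) := fun x w => by
    have h := congrArg (fun T : H →L[ℂ] H => T w) (hPU x)
    simpa only [mul_apply_eq_comp] using h
  have hnJ : ∀ v, ‖Jc v‖ = ‖v‖ := fun v => by rw [hJ]; exact J.norm_map v
  refine ⟨Jc ∘L P ∘L Jc.adjoint, fun x => Jc ∘L U x ∘L Jc.adjoint + (1 - Jc ∘L Jc.adjoint), hPsa.conj_adjoint Jc,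
    (hPc.comp_clm Jc.adjoint).clm_comp Jc, fun v => ?_, ?_, fun x y => ?_, fun x v => ?_, fun x => ?_, fun n x ψ => ?_⟩
  · rw [ContinuousLinearMap.comp_apply, ContinuousLinearMap.comp_apply, ← ContinuousLinearMap.adjoint_inner_right]
    exact hPpos _
  · ext v
    simp only [hU0, add_apply, sub_apply, ContinuousLinearMap.comp_apply,
      one_apply_eq_self]
    abel
  · ext v
    simp only [hUadd, add_apply, sub_apply, ContinuousLinearMap.comp_apply,
      one_apply_eq_self, mul_apply_eq_comp, map_add, map_sub, hAJv, sub_self, add_zero]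
    abel
  · have hq : ∀ w, ⟪Jc w, (1 - Jc ∘L Jc.adjoint) v⟫_ℂ = 0 := fun w => by
      rw [← ContinuousLinearMap.adjoint_inner_right, hAQ, inner_zero_right]
    have ha : ‖Jc (U x (Jc.adjoint v))‖ = ‖Jc (Jc.adjoint v)‖ := by rw [hnJ, hnJ, hUnorm]
    have hv : v = Jc (Jc.adjoint v) + (1 - Jc ∘L Jc.adjoint) v := by
      rw [sub_apply, one_apply_eq_self, ContinuousLinearMap.comp_apply]; abel
    have e1 := norm_add_sq_eq_norm_sq_add_norm_sq_of_inner_eq_zero _ _ (hq (U x (Jc.adjoint v)))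
    have e2 := norm_add_sq_eq_norm_sq_add_norm_sq_of_inner_eq_zero _ _ (hq (Jc.adjoint v))
    rw [← hv] at e2
    rw [add_apply, ContinuousLinearMap.comp_apply, ContinuousLinearMap.comp_apply]
    have h3 : ‖Jc (U x (Jc.adjoint v)) + (1 - Jc ∘L Jc.adjoint) v‖ * ‖Jc (U x (Jc.adjoint v)) + (1 - Jc ∘L Jc.adjoint) v‖ =
        ‖v‖ * ‖v‖ := by rw [e1, e2, ha]
    exact (mul_self_inj (norm_nonneg _) (norm_nonneg _)).1 h3
  · ext v
    simp only [mul_apply_eq_comp, add_apply, sub_apply,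
      ContinuousLinearMap.comp_apply, one_apply_eq_self, map_add, map_sub, hAJv, sub_self, add_zero, hPUv]
  · simp only [← hJ]
    have hU' : (Jc ∘L U x ∘L Jc.adjoint + (1 - Jc ∘L Jc.adjoint)) (Jc ψ) = Jc (U x ψ) := by
      simp only [add_apply, sub_apply, ContinuousLinearMap.comp_apply,
        one_apply_eq_self, hAJv, sub_self, add_zero]
    rw [hU']
    induction n with
    | zero => simp only [pow_zero, one_apply_eq_self]
    | succ n ih =>
      simp only [pow_succ', mul_apply_eq_comp, ih, ContinuousLinearMap.comp_apply, hAJv]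

end Transport

/-! ## §3 Re-indexing a countable family by `ℕ` -/

/-- A countable family of data with non-negative weights can be re-indexed by `ℕ` — padding with weight `0` and a default datum
satisfying the same predicate — without changing any weighted `HasSum`. [folklore] -/
theorem exists_nat_reindex {κ : Type*} [Countable κ] {α β γ : Type*} (pw : κ → ℝ) (P' : κ → α) (U' : κ → β) (ψ' : κ → γ)
    (Good : α → β → Prop) (a0 : α) (b0 : β) (c0 : γ) (h0 : Good a0 b0) (hpw : ∀ k, 0 ≤ pw k) (hk : ∀ k, Good (P' k) (U' k)) :
    ∃ (p : ℕ → ℝ) (P : ℕ → α) (U : ℕ → β) (ψ : ℕ → γ), (∀ i, 0 ≤ p i) ∧ (∀ i, Good (P i) (U i)) ∧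
      ∀ (F : α → β → γ → ℝ) (a : ℝ), HasSum (fun k => pw k * F (P' k) (U' k) (ψ' k)) a →
        HasSum (fun i => p i * F (P i) (U i) (ψ i)) a := by
  classical
  obtain ⟨ι, hι⟩ := Countable.exists_injective_nat κ
  refine ⟨extend ι pw 0, extend ι P' (fun _ => a0), extend ι U' (fun _ => b0), extend ι ψ' (fun _ => c0), fun i => ?_, fun i => ?_,
    fun F a h => ?_⟩
  · by_cases hi : ∃ k, ι k = i
    · obtain ⟨k, rfl⟩ := hi; rw [hι.extend_apply]; exact hpw k
    · rw [extend_apply' _ _ _ hi]; exact le_rfl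
  · by_cases hi : ∃ k, ι k = i
    · obtain ⟨k, rfl⟩ := hi; rw [hι.extend_apply, hι.extend_apply]; exact hk k
    · rw [extend_apply' _ _ _ hi, extend_apply' _ _ _ hi]; exact h0
  · have hf : (fun i => extend ι pw 0 i * F (extend ι P' (fun _ => a0) i) (extend ι U' (fun _ => b0) i) (extend ι ψ' (fun _ => c0) i)) =
        extend ι (fun k => pw k * F (P' k) (U' k) (ψ' k)) 0 := by
      funext i
      by_cases hi : ∃ k, ι k = i
      · obtain ⟨k, rfl⟩ := hi; rw [hι.extend_apply, hι.extend_apply, hι.extend_apply, hι.extend_apply, hι.extend_apply]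
      · simp only [extend_apply' _ _ _ hi, zero_mul, Pi.zero_apply]
    rw [hf]
    exact (hasSum_extend_zero hι).2 h

end Summit.QuantumFields.YangMills.Theorems.TorusKL.Transport

end
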